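import Literature.Topology.FourManifolds.FishtailTubeForms
import Literature.Topology.FourManifolds.FishtailParamsLoc
import HarnessLib

/-!
# The fishtail end map is injective

Infrastructure for the explicit fishtail neighbourhood (R. Gompf, *More Cappell–Shaneson spheres
are standard*, Algebr. Geom. Topol. 10 (2010), proof of Thm 2.1 and Lemma 2.2; the named fact
`Literature.Topology.FourManifolds.gompf2010_framedTwist`). The end map `ι` of the concrete data
`fishJ` is injective on the model end (`FP.injective_iotaO`):

* points far from the surgery circle (`Far`: fibre angle in `[1, 5]`) — the box shell and the
  corner — are never identified with tube points of the surgery nor with new points, and `toSurg`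
  is injective at them against every point;
* the box shell, the corner and the hole piece are each injective (decoding the model point from
  the face profile `face_inj`, from Gompf's bend `fishBendInv`, and from the embedded tube
  `FP.injOn_tubeD`);
* they are pairwise disjoint off their junctions (the taxonomy `FP.hole_taxonomy` of the tube
  points against `t ≥ 1 + e h` on the box and `t > 249/250` on the unbent corner; the bent corner
  *is* the tube beyond the hole radius);
* the mapping torus is covered by `[x, s]`, `s ∈ [1/2, 3/2)`.

Everything is proved; no named facts.

## References

* R. E. Gompf, *More Cappell–Shaneson spheres are standard*, Algebr. Geom. Topol. 10 (2010)
  1665–1681, proof of Thm 2.1 and Lemma 2.2. [GompfAGT2010]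
-/

noncomputable section

open scoped Real Topology ContDiff Manifold
open Set Filter Complex Metric

namespace Literature.Topology.FourManifolds

local notation "𝔼 " n:arg => EuclideanSpace ℝ (Fin n)

namespace FP

variable {ε : ℝ} (hε : 0 < ε) (hε2 : ε ≤ 1 / 2)

/-! ### Points far from the surgery circle -/

/-- A point of the mapping torus **far from the surgery circle**: fibre angle in `[1, 5]`. [folklore] -/
def Far (m : MTorus tubeShearDiffeo) : Prop := ∃ y : ℝ, yC m = Circle.exp y ∧ 1 ≤ y ∧ y ≤ 5

include hε2 in
/-- Tube points of the surgery have fibre angle below `ε`. [folklore] -/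
theorem yC_of_mem_range {p : MTorus tubeShearDiffeo} (hp : p ∈ range (fishNu hε hε2).toFun) :
    ∃ v : 𝔼 3, ‖v‖ < ε ∧ yC p = Circle.exp (v 1) := by
  obtain ⟨⟨u, w⟩, rfl⟩ := hp
  refine ⟨(TubeTwist.const ε hε (le_pi_of_le_half hε2)).shrink w, TubeTwist.norm_shrink_const_lt hε _ w, ?_⟩
  rcases ne_ptA_or_ne_ptB u with hu | hu
  · rw [show (fishNu hε hε2).toFun (u, w) = _ from prodTube_apply_of_ne tubeShearDiffeo ε hε (le_pi_of_le_half hε2) (tubeShearDiffeo_expT hε2) hu w]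
    rfl
  · rw [show (fishNu hε hε2).toFun (u, w) = _ from prodTube_apply_of_ne_ptB tubeShearDiffeo ε hε (le_pi_of_le_half hε2) (tubeShearDiffeo_expT hε2) hu w]
    rfl

include hε2 in
/-- **Far points are not tube points.** [folklore] -/
theorem Far.not_mem_range {m : MTorus tubeShearDiffeo} (h : Far m) : m ∉ range (fishNu hε hε2).toFun := by
  intro hm
  obtain ⟨y, hy, hy1, hy5⟩ := h
  obtain ⟨v, hv, hyv⟩ := yC_of_mem_range hε hε2 hm
  rw [hy] at hyv
  have hv1 : |v 1| < ε := lt_of_le_of_lt (by rw [← Real.norm_eq_abs]; exact PiLp.norm_apply_le v 1) hv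
  have := eq_of_circleExp_eq hyv (by rw [abs_lt] at hv1 ⊢; constructor <;> linarith [Real.pi_gt_three])
  rw [this] at hy1; linarith [(abs_lt.1 hv1).2]

include hε2 in
/-- Far points lie off the surgery circle. [folklore] -/
theorem Far.mem_complement {m : MTorus tubeShearDiffeo} (h : Far m) : m ∈ (fishNu hε hε2).complement := by
  rw [CircleNbhd.mem_complement_iff]
  rintro ⟨u, hu⟩
  exact h.not_mem_range hε hε2 ⟨(u, 0), by rw [(fishNu hε hε2).apply_zero]; exact hu⟩

include hε2 in
/-- **`toSurg` is injective at far points against every point.** [folklore] -/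
theorem Far.eq_of_toSurg_eq {m m' : MTorus tubeShearDiffeo} (h : Far m) (he : toSurg (fishNu hε hε2) m = toSurg (fishNu hε hε2) m') :
    m = m' := by
  have hm := h.mem_complement hε hε2
  by_cases hm' : m' ∈ (fishNu hε hε2).complement
  · exact toSurg_inj hm hm' he
  · exfalso
    rw [toSurg_eq_inl hm, toSurg, dif_neg hm'] at he
    have := congrArg Subtype.val ((fishNu hε hε2).glueData.inl_injective he)
    exact h.not_mem_range hε hε2 ⟨_, this.symm⟩

include hε2 in
/-- **A far point is never a new point.** [folklore] -/
theorem Far.toSurg_ne_inr {m : MTorus tubeShearDiffeo} (h : Far m) (b : ↥discTimesSphere) :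
    toSurg (fishNu hε hε2) m ≠ (fishNu hε hε2).glueData.inr b := by
  intro he
  have hm := h.mem_complement hε hε2
  rw [toSurg_eq_inl hm, SmoothGlueData.inl_eq_inr_iff, CircleNbhd.glueData_glue, CircleNbhd.glue_source] at he
  exact h.not_mem_range hε hε2 ((fishNu hε hε2).puncturedTube_subset_range he.1)

/-- `Far (mtPt tubeShearDiffeo (z₁, Circle.exp y, z₃) s)`. [folklore] -/
theorem far_mtPt {z₁ z₃ : Circle} {y s : ℝ} (hs0 : 0 < s) (hs1 : s < 3 / 2) (hy1 : 1 ≤ y) (hy5 : y ≤ 5) :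
    Far (mtPt tubeShearDiffeo (z₁, Circle.exp y, z₃) s) :=
  ⟨y, yC_mtPt _ hs0 hs1, hy1, hy5⟩

/-! ### The pieces of the concrete end map -/

section Pieces

/-- The depth of a model point with `im z₁ > 0` lies in `(0, E₁)`. [folklore] -/
theorem depth_mem' {x : ThreeTorus} (hx : 0 < (x.1 : ℂ).im) : 0 < (fishJ ε hε hε2).depth x.1 ∧ (fishJ ε hε hε2).depth x.1 < E1 :=
  (fishJ ε hε hε2).depth_mem E1_pos hx

/-- **The box shell point.** [folklore] -/
theorem boxP_eq (x : ThreeTorus) (s : ℝ) : (fishJ ε hε hε2).boxP x s =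
    toSurg (fishNu hε hε2) (mtPt tubeShearDiffeo
      (Circle.exp ((fishJ ε hε hε2).lat x.2.1) * (x.2.2 * (fishJ ε hε hε2).twistC ((fishJ ε hε hε2).lat x.2.1) s)⁻¹,
        Circle.exp (faceY (thetaV s) ((fishJ ε hε hε2).depth x.1)), x.2.2 * (fishJ ε hε hε2).twistC ((fishJ ε hε hε2).lat x.2.1) s)
      (faceT (thetaV s) ((fishJ ε hε hε2).depth x.1))) := rfl

/-- **Box data ranges**: `1 + e h ≤ t ≤ 7/5` and `y ∈ [c_Y - 5/4, c_Y + 5/4]`. [folklore] -/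
theorem box_mem {x : ThreeTorus} (hx : 0 < (x.1 : ℂ).im) (s : ℝ) :
    1 + (fishJ ε hε hε2).depth x.1 * bxH ≤ faceT (thetaV s) ((fishJ ε hε hε2).depth x.1) ∧
      faceT (thetaV s) ((fishJ ε hε hε2).depth x.1) ≤ 7 / 5 ∧
      |faceY (thetaV s) ((fishJ ε hε hε2).depth x.1) - cY| ≤ 5 / 4 := by
  obtain ⟨he0, he1⟩ := depth_mem' hε hε2 hx
  have hE := E1_le
  exact ⟨faceT_ge (by linarith), faceT_le he0.le (by linarith), abs_faceY_sub_le he0.le (by linarith)⟩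

/-- The box shell point is far. [folklore] -/
theorem far_box {x : ThreeTorus} (hx : 0 < (x.1 : ℂ).im) (s : ℝ) :
    Far (mtPt tubeShearDiffeo
      (Circle.exp ((fishJ ε hε hε2).lat x.2.1) * (x.2.2 * (fishJ ε hε hε2).twistC ((fishJ ε hε hε2).lat x.2.1) s)⁻¹,
        Circle.exp (faceY (thetaV s) ((fishJ ε hε hε2).depth x.1)), x.2.2 * (fishJ ε hε hε2).twistC ((fishJ ε hε hε2).lat x.2.1) s)
      (faceT (thetaV s) ((fishJ ε hε hε2).depth x.1))) := by
  obtain ⟨ht1, ht2, hy⟩ := box_mem hε hε2 hx s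
  obtain ⟨he0, -⟩ := depth_mem' hε hε2 hx
  have hcY : cY = π - 1 / 4 := rfl
  obtain ⟨hy1, hy2⟩ := abs_le.1 hy
  refine far_mtPt (by rw [bxH] at ht1; nlinarith) (by linarith) ?_ ?_ <;> linarith [Real.pi_gt_three, Real.pi_lt_d2]

/-- Abbreviations for the corner data of a model point. [folklore] -/
def cW (x : ThreeTorus) (s : ℝ) : ℝ := ((fishJ ε hε hε2).bendWE x s).1
/-- The constant `cE = ((fishJ ε hε hε2).bendWE x s).2` of the fishtail data. [folklore] -/
def cE (x : ThreeTorus) (s : ℝ) : ℝ := ((fishJ ε hε hε2).bendWE x s).2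
/-- The unit corner vector `u` of a corner point. [folklore] -/
def cU (x : ThreeTorus) (s : ℝ) : ℂ := (unitC ((fishJ ε hε hε2).holeP0 x s) : ℂ)
/-- The fibre coordinate `f` of a corner point. [folklore] -/
def cF (x : ThreeTorus) (s : ℝ) : Circle := x.2.2 * unitC ((fishJ ε hε hε2).holeP0 x s) * Circle.exp (-(fishJ ε hε hε2).liftS ((fishJ ε hε hε2).holeP0 x s))

/-- **The corner point.** [folklore] -/
theorem cornerP_eq (x : ThreeTorus) (s : ℝ) : (fishJ ε hε hε2).cornerP x s =
    toSurg (fishNu hε hε2) (mtPt tubeShearDiffeo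
      (Circle.exp (nj ε + cW hε hε2 x s * (cU hε hε2 x s).re) * (cF hε hε2 x s)⁻¹,
        Circle.exp (cY + cW hε hε2 x s * (cU hε hε2 x s).im), cF hε hε2 x s)
      (1 + cE hε hε2 x s * bxH)) := rfl

include hε hε2 in
/-- `c · r_c ≤ L_c + 3/50` and the corner radii in order: `0 < r_h < ρ_b < r_c ≤ 1/10`. [folklore] -/
theorem radii :
    0 < (fishJ ε hε hε2).rh ∧ (fishJ ε hε hε2).rh = rhJ ε hε hε2 ∧ (fishJ ε hε hε2).rc = rhoB ε hε hε2 + 2 * delC ε hε hε2 ∧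
      (fishJ ε hε hε2).rh < rhoB ε hε hε2 ∧ rhoB ε hε hε2 < (fishJ ε hε hε2).rc ∧ (fishJ ε hε hε2).rc ≤ 1 / 10 ∧
      0 < delC ε hε hε2 ∧ delC ε hε hε2 ≤ rhoB ε hε hε2 / 100 ∧ cL ε hε hε2 * p1 ε hε hε2 = 1 / 50 ∧
      cL ε hε hε2 * delC ε hε hε2 = 3 / 100 ∧ 0 < p1 ε hε hε2 := by
  have H := locHyp hε hε2
  have hc := cL_pos ε hε hε2
  have hρ := rhoB_pos hε hε2; have hρ' := rhoB_le' hε hε2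
  have hδ : 0 < delC ε hε hε2 := H.hδ
  have hp : 0 < p1 ε hε hε2 := H.hp₁
  have hE : 0 < E1 / cL ε hε hε2 := div_pos E1_pos hc
  have hcp : cL ε hε hε2 * p1 ε hε hε2 = 1 / 50 := by rw [p1]; field_simp
  have hcd : cL ε hε hε2 * delC ε hε hε2 = 3 / 100 := by rw [delC]; field_simp
  -- `δ_c = 3/(100 c) ≤ ρ_b/100` since `c ρ_b = L_c ≥ 30`… indeed `c ρ_b ≥ 3`
  have hδρ : delC ε hε hε2 ≤ rhoB ε hε hε2 / 100 := by
    have hL : 30 ≤ cL ε hε hε2 * rhoB ε hε hε2 := by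
      rw [cL_mul_rhoB' ε hε hε2, Lc]; linarith [s7_gt ε hε, tan_beta7_ge (ε := ε)]
    rw [delC, div_le_div_iff₀ (by positivity) (by norm_num)]; nlinarith
  refine ⟨H.hrh.trans' H.hδ |> fun h ↦ by linarith [H.hrh, H.hδ], rfl, rfl, ?_, ?_, ?_, hδ, hδρ, hcp, hcd, hp⟩
  · show rhoB ε hε hε2 - delC ε hε hε2 - p1 ε hε hε2 - E1 / cL ε hε hε2 < rhoB ε hε hε2; linarith
  · show rhoB ε hε hε2 < rhoB ε hε hε2 + 2 * delC ε hε hε2; linarith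
  · show rhoB ε hε hε2 + 2 * delC ε hε hε2 ≤ 1 / 10; linarith

include hε hε2 in
/-- **Corner data ranges** in corner mode (`r_h ≤ |p₀| < r_c`, `im z₁ > 0`):
`0 < W < r_c`, `-3/50 ≤ E ≤ e < E₁`, and `E > -1/50` off the handle (`p > -p₁`). [folklore] -/
theorem corner_mem {x : ThreeTorus} (hx : 0 < (x.1 : ℂ).im) {s : ℝ}
    (h1 : (fishJ ε hε hε2).rh ≤ ‖(fishJ ε hε hε2).holeP0 x s‖) (h2 : ‖(fishJ ε hε hε2).holeP0 x s‖ < (fishJ ε hε hε2).rc) :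
    0 < cW hε hε2 x s ∧ cW hε hε2 x s < (fishJ ε hε hε2).rc ∧ -(3 / 50) ≤ cE hε hε2 x s ∧ cE hε hε2 x s < E1 ∧
      (-(p1 ε hε hε2) < ‖(fishJ ε hε hε2).holeP0 x s‖ - rhoB ε hε hε2 + (fishJ ε hε hε2).depth x.1 / cL ε hε hε2 →
        -(1 / 50) < cE hε hε2 x s) := by
  obtain ⟨hrh0, hrhJ, hrc, hrhρ, hρrc, hrc1, hδ0, hδρ, hcp, hcd, hp0⟩ := radii hε hε2
  obtain ⟨he0, he1⟩ := depth_mem' hε hε2 hx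
  have hc := cL_pos ε hε hε2
  set ϱ := ‖(fishJ ε hε hε2).holeP0 x s‖ with hϱ
  set e := (fishJ ε hε hε2).depth x.1 with he
  have hb := fishBend_bounds (ρb := rhoB ε hε hε2) hc hp0 (x := (ϱ, e)) (by simp only; linarith) he0.le
  have hW1 := le_fishBend_fst (ρb := rhoB ε hε hε2) hc.ne' hp0 (ϱ, e)
  simp only at hb hW1
  have hWdef : cW hε hε2 x s = (fishBend (cL ε hε hε2) (p1 ε hε hε2) (rhoB ε hε hε2) (ϱ, e)).1 := rfl
  have hEdef : cE hε hε2 x s = (fishBend (cL ε hε hε2) (p1 ε hε hε2) (rhoB ε hε hε2) (ϱ, e)).2 := rfl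
  rw [hWdef, hEdef]
  obtain ⟨hbW, hbE1, hbE2⟩ := hb
  have hcrh : cL ε hε hε2 * (fishJ ε hε hε2).rh = Lc ε - 1 / 20 - E1 := by rw [hrhJ]; exact cL_mul_rhJ hε hε2
  have hcρ := cL_mul_rhoB' ε hε hε2
  refine ⟨by linarith, lt_of_le_of_lt hbW (max_lt h2 hρrc), ?_, by linarith, fun hp ↦ ?_⟩
  · have : -(3 / 50) ≤ min (cL ε hε hε2 * (ϱ - rhoB ε hε hε2)) 0 := by
      refine le_min ?_ (by norm_num)
      have := mul_le_mul_of_nonneg_left h1 hc.le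
      nlinarith [E1_le]
    linarith
  · -- off the handle: `E = e + c p λ ≥ e + c p > e - c p₁ ≥ -1/50`
    rw [fishBend]
    simp only
    set p := ϱ - rhoB ε hε hε2 + e / cL ε hε hε2 with hpdef
    have hl0 := Real.smoothTransition.nonneg (-p / p1 ε hε hε2)
    have hl1 := Real.smoothTransition.le_one (-p / p1 ε hε hε2)
    rw [bendF]
    rcases le_or_gt 0 p with hp0' | hpneg
    · have : 0 ≤ cL ε hε hε2 * p * Real.smoothTransition (-p / p1 ε hε hε2) := by positivity
      linarith
    · have h3 : cL ε hε hε2 * p * 1 ≤ cL ε hε hε2 * p * Real.smoothTransition (-p / p1 ε hε hε2) :=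
        mul_le_mul_of_nonpos_left hl1 (by nlinarith)
      nlinarith

/-- The corner point is far and its base is in `[1/2, 3/2)`. [folklore] -/
theorem far_corner {x : ThreeTorus} (hx : 0 < (x.1 : ℂ).im) {s : ℝ}
    (h1 : (fishJ ε hε hε2).rh ≤ ‖(fishJ ε hε hε2).holeP0 x s‖) (h2 : ‖(fishJ ε hε hε2).holeP0 x s‖ < (fishJ ε hε hε2).rc) :
    Far (mtPt tubeShearDiffeo
      (Circle.exp (nj ε + cW hε hε2 x s * (cU hε hε2 x s).re) * (cF hε hε2 x s)⁻¹,
        Circle.exp (cY + cW hε hε2 x s * (cU hε hε2 x s).im), cF hε hε2 x s)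
      (1 + cE hε hε2 x s * bxH)) ∧
    49 / 50 ≤ 1 + cE hε hε2 x s * bxH ∧ 1 + cE hε hε2 x s * bxH < 3 / 2 ∧
      |cW hε hε2 x s * (cU hε hε2 x s).im| ≤ 1 / 10 ∧ |cW hε hε2 x s * (cU hε hε2 x s).re| ≤ 1 / 10 := by
  obtain ⟨hW0, hWrc, hE0, hE1, -⟩ := corner_mem hε hε2 hx h1 h2
  obtain ⟨hrh0, -, -, -, -, hrc1, -⟩ := radii hε hε2
  have hE := E1_le
  have hp0 : (fishJ ε hε hε2).holeP0 x s ≠ 0 := by rw [← norm_pos_iff]; linarith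
  have hu1 : ‖cU hε hε2 x s‖ = 1 := by rw [cU, Circle.norm_coe]
  have hui : |(cU hε hε2 x s).im| ≤ 1 := (abs_im_le_norm _).trans hu1.le
  have hur : |(cU hε hε2 x s).re| ≤ 1 := (abs_re_le_norm _).trans hu1.le
  have hWi : |cW hε hε2 x s * (cU hε hε2 x s).im| ≤ 1 / 10 := by
    rw [abs_mul, abs_of_pos hW0]; nlinarith [abs_nonneg ((cU hε hε2 x s).im)]
  have hWr : |cW hε hε2 x s * (cU hε hε2 x s).re| ≤ 1 / 10 := by
    rw [abs_mul, abs_of_pos hW0]; nlinarith [abs_nonneg ((cU hε hε2 x s).re)]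
  have hcY : cY = π - 1 / 4 := rfl
  refine ⟨far_mtPt (by rw [bxH]; linarith) (by rw [bxH]; linarith) ?_ ?_, by rw [bxH]; linarith, by rw [bxH]; linarith, hWi, hWr⟩
  · linarith [(abs_le.1 hWi).1, Real.pi_gt_three]
  · linarith [(abs_le.1 hWi).2, Real.pi_lt_d2]

/-- **In the hole region the bend is in handle mode**: `(W, E) = (ρ_b - e/c, c(ϱ - ρ_b) + 2e)`. [folklore] -/
theorem bendWE_of_hole {x : ThreeTorus} (hx : 0 < (x.1 : ℂ).im) {s : ℝ} (h : ‖(fishJ ε hε hε2).holeP0 x s‖ < (fishJ ε hε hε2).rh) :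
    (fishJ ε hε hε2).bendWE x s = (rhoB ε hε hε2 - (fishJ ε hε hε2).depth x.1 / cL ε hε hε2,
      cL ε hε hε2 * (‖(fishJ ε hε hε2).holeP0 x s‖ - rhoB ε hε hε2) + 2 * (fishJ ε hε hε2).depth x.1) := by
  obtain ⟨hrh0, hrhJ, -, -, -, -, hδ0, -, -, -, hp0⟩ := radii hε hε2
  obtain ⟨he0, he1⟩ := depth_mem' hε hε2 hx
  have hc := cL_pos ε hε hε2
  rw [IotaData.bendWE]
  refine fishBend_of_le hc.ne' hp0 ?_
  simp only
  have hec : (fishJ ε hε hε2).depth x.1 / cL ε hε hε2 ≤ E1 / cL ε hε hε2 := div_le_div_of_nonneg_right he1.le hc.le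
  have : (fishJ ε hε hε2).rh = rhoB ε hε hε2 - delC ε hε hε2 - p1 ε hε hε2 - E1 / cL ε hε hε2 := rfl
  show ‖(fishJ ε hε hε2).holeP0 x s‖ - rhoB ε hε hε2 + (fishJ ε hε hε2).depth x.1 / cL ε hε hε2 ≤ -p1 ε hε hε2
  linarith

/-- **The hole point is a tube point with admissible offset and position below `c r_h`.** [folklore] -/
theorem hole_tube {x : ThreeTorus} (hx : 0 < (x.1 : ℂ).im) {s : ℝ} (h : ‖(fishJ ε hε hε2).holeP0 x s‖ < (fishJ ε hε hε2).rh) :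
    (fishJ ε hε hε2).holeP x s = (fishT ε hε hε2).tubeD ((fishJ ε hε hε2).holeZeta x s, ((fishJ ε hε hε2).holeW x s).re, ((fishJ ε hε hε2).holeW x s).im) ∧
      ‖(fishJ ε hε hε2).holeZeta x s‖ < cL ε hε hε2 * rhJ ε hε hε2 ∧
      (((fishJ ε hε hε2).holeW x s).re, ((fishJ ε hε hε2).holeW x s).im) ∈ AdmP ε hε hε2 ∧
      ‖(fishJ ε hε hε2).holeW x s‖ = rhoB ε hε hε2 - (fishJ ε hε hε2).depth x.1 / cL ε hε hε2 := by
  obtain ⟨hrh0, hrhJ, -, hrhρ, -⟩ := radii hε hε2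
  obtain ⟨he0, he1⟩ := depth_mem' hε hε2 hx
  have hc := cL_pos ε hε hε2
  have hWE := bendWE_of_hole hε hε2 hx h
  have hnormW : ‖(fishJ ε hε hε2).holeW x s‖ = rhoB ε hε hε2 - (fishJ ε hε hε2).depth x.1 / cL ε hε hε2 := by
    rw [IotaData.holeW, norm_mul, norm_mul, Circle.norm_coe, Circle.norm_coe, mul_one, mul_one, Complex.norm_real, Real.norm_eq_abs,
      hWE]
    simp only
    have hec : (fishJ ε hε hε2).depth x.1 / cL ε hε hε2 < E1 / cL ε hε hε2 := div_lt_div_of_pos_right he1 hc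
    exact abs_of_pos (by linarith [E1_div_cL_le (hε := hε) (hε2 := hε2), rhoB_pos hε hε2])
  refine ⟨rfl, ?_, ?_, hnormW⟩
  · rw [(fishJ ε hε hε2).norm_holeZeta hc, ← hrhJ]; exact mul_lt_mul_of_pos_left h hc
  · have hsq : ((fishJ ε hε hε2).holeW x s).re ^ 2 + ((fishJ ε hε hε2).holeW x s).im ^ 2 = ‖(fishJ ε hε hε2).holeW x s‖ ^ 2 := by
      rw [Complex.sq_norm, Complex.normSq_apply]; ring
    have hec0 : 0 < (fishJ ε hε hε2).depth x.1 / cL ε hε hε2 := div_pos he0 hc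
    have hec : (fishJ ε hε hε2).depth x.1 / cL ε hε hε2 < E1 / cL ε hε hε2 := div_lt_div_of_pos_right he1 hc
    have hlo : 0 < rhoB ε hε hε2 - E1 / cL ε hε hε2 := by linarith [E1_div_cL_le (hε := hε) (hε2 := hε2), rhoB_pos hε hε2]
    refine ⟨?_, ?_⟩
    · show (rhoB ε hε hε2 - E1 / cL ε hε hε2) ^ 2 < ((fishJ ε hε hε2).holeW x s).re ^ 2 + ((fishJ ε hε hε2).holeW x s).im ^ 2
      rw [hsq, hnormW]; nlinarith
    · show ((fishJ ε hε hε2).holeW x s).re ^ 2 + ((fishJ ε hε hε2).holeW x s).im ^ 2 < rhoB ε hε hε2 ^ 2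
      rw [hsq, hnormW]; nlinarith

end Pieces

/-! ### Decoding the model point -/

section Decode

/-- A point of the circle is determined by its argument. [folklore] -/
theorem circle_eq_of_arg_eq {a b : Circle} (h : arg (a : ℂ) = arg (b : ℂ)) : a = b :=
  Subtype.ext (by rw [← norm_mul_exp_arg_mul_I (a : ℂ), ← norm_mul_exp_arg_mul_I (b : ℂ), Circle.norm_coe, Circle.norm_coe, h])

/-- A point of the upper half of the circle is determined by its real part. [folklore] -/
theorem circle_eq_of_re_eq {a b : Circle} (ha : 0 < (a : ℂ).im) (hb : 0 < (b : ℂ).im) (h : (a : ℂ).re = (b : ℂ).re) : a = b := by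
  have ha1 : (a : ℂ).re ^ 2 + (a : ℂ).im ^ 2 = 1 := by
    have := Circle.normSq_coe a; rw [Complex.normSq_apply] at this; nlinarith
  have hb1 : (b : ℂ).re ^ 2 + (b : ℂ).im ^ 2 = 1 := by
    have := Circle.normSq_coe b; rw [Complex.normSq_apply] at this; nlinarith
  have him : (a : ℂ).im = (b : ℂ).im := by
    have h2 : (a : ℂ).im ^ 2 = (b : ℂ).im ^ 2 := by rw [h] at ha1; linarith
    nlinarith
  exact Subtype.ext (Complex.ext h him)

/-- **The depth determines `z₁`** on the model end. [folklore] -/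
theorem z1_eq_of_depth_eq {z z' : Circle} (hz : 0 < (z : ℂ).im) (hz' : 0 < (z' : ℂ).im)
    (h : (fishJ ε hε hε2).depth z = (fishJ ε hε hε2).depth z') : z = z' := by
  have hE := E1_pos
  have h' : (z : ℂ).re = (z' : ℂ).re := by
    have : (fishJ ε hε hε2).E₁ = E1 := rfl
    rw [IotaData.depth, IotaData.depth, this] at h
    have := mul_left_cancel₀ hE.ne' (show E1 * (1 - (z : ℂ).re) = E1 * (1 - (z' : ℂ).re) by linarith)
    linarith
  exact circle_eq_of_re_eq hz hz' h'

/-- The hole coordinate in real and imaginary parts. [folklore] -/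
theorem holeP0_re_im (x : ThreeTorus) (s : ℝ) :
    ((fishJ ε hε hε2).holeP0 x s).re = (fishJ ε hε hε2).lat x.2.1 - nj ε ∧
      ((fishJ ε hε hε2).holeP0 x s).im = (1 - (fishJ ε hε hε2).depth x.1) * bxH * Real.tan (2 * π * (s - 1)) := by
  rw [IotaData.holeP0]
  have : (fishJ ε hε hε2).nj = nj ε := rfl
  rw [this]
  refine ⟨?_, ?_⟩
  · simp only [Complex.add_re, Complex.ofReal_re, Complex.mul_re, Complex.ofReal_im, Complex.I_re, Complex.I_im]; ring
  · simp only [Complex.add_im, Complex.ofReal_im, Complex.mul_im, Complex.ofReal_re, Complex.I_re, Complex.I_im]; ring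

/-- The latitude datum determines `z₂`. [folklore] -/
theorem z2_eq_of_lat_eq {z z' : Circle} (h : (fishJ ε hε hε2).lat z = (fishJ ε hε hε2).lat z') : z = z' := by
  rw [IotaData.lat, IotaData.lat] at h
  exact circle_eq_of_arg_eq (by linarith)

/-- **The hole coordinate and the depth determine `(z₂, s)`** on the face band `|s - 1| < 1/5`. [folklore] -/
theorem decode_p0 {x x' : ThreeTorus} (hx' : 0 < (x'.1 : ℂ).im) {s s' : ℝ} (hs : |s - 1| < 1 / 5) (hs' : |s' - 1| < 1 / 5)
    (hd : (fishJ ε hε hε2).depth x.1 = (fishJ ε hε hε2).depth x'.1) (hp : (fishJ ε hε hε2).holeP0 x s = (fishJ ε hε hε2).holeP0 x' s') :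
    x.2.1 = x'.2.1 ∧ s = s' := by
  have hπ := Real.pi_pos
  obtain ⟨hr, hi⟩ := holeP0_re_im hε hε2 x s
  obtain ⟨hr', hi'⟩ := holeP0_re_im hε hε2 x' s'
  obtain ⟨-, he1⟩ := depth_mem' hε hε2 hx'
  have hE := E1_le
  refine ⟨z2_eq_of_lat_eq hε hε2 (by have := congrArg Complex.re hp; rw [hr, hr'] at this; linarith), ?_⟩
  have him := congrArg Complex.im hp
  rw [hi, hi', hd] at him
  have h1e : 0 < (1 - (fishJ ε hε hε2).depth x'.1) * bxH := by rw [bxH]; nlinarith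
  have htan : Real.tan (2 * π * (s - 1)) = Real.tan (2 * π * (s' - 1)) := mul_left_cancel₀ h1e.ne' him
  have hmem : ∀ {σ : ℝ}, |σ - 1| < 1 / 5 → 2 * π * (σ - 1) ∈ Ioo (-(π / 2)) (π / 2) := by
    intro σ hσ; obtain ⟨h1, h2⟩ := abs_lt.1 hσ; constructor <;> nlinarith
  have := Real.injOn_tan (hmem hs) (hmem hs') htan
  nlinarith

end Decode

/-! ### Injectivity of the three pieces -/

section PieceInj

include hε2 in
/-- **The box shell is injective** on the model end with bases in `[1/2, 3/2)`. [folklore] -/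
theorem box_inj {x x' : ThreeTorus} (hx : 0 < (x.1 : ℂ).im) (hx' : 0 < (x'.1 : ℂ).im) {s s' : ℝ}
    (hs : 1 / 2 ≤ s ∧ s < 3 / 2) (hs' : 1 / 2 ≤ s' ∧ s' < 3 / 2)
    (h : (fishJ ε hε hε2).boxP x s = (fishJ ε hε hε2).boxP x' s') : x = x' ∧ s = s' := by
  have hπ := Real.pi_pos
  rw [boxP_eq, boxP_eq] at h
  obtain ⟨ht1, ht2, hy⟩ := box_mem hε hε2 hx s
  obtain ⟨ht1', ht2', hy'⟩ := box_mem hε hε2 hx' s'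
  obtain ⟨he0, he1⟩ := depth_mem' hε hε2 hx
  obtain ⟨he0', he1'⟩ := depth_mem' hε hε2 hx'
  have hE := E1_le
  have hm := (far_box hε hε2 hx s).eq_of_toSurg_eq hε hε2 h
  obtain ⟨hX, hT⟩ := mtPt_inj_Ico ⟨by rw [bxH] at ht1; nlinarith, by linarith⟩ ⟨by rw [bxH] at ht1'; nlinarith, by linarith⟩ hm
  obtain ⟨h1, h23⟩ := Prod.ext_iff.1 hX
  obtain ⟨h2, h3⟩ := Prod.ext_iff.1 h23
  simp only at h1 h2 h3
  -- the face: `y` and `t` give `e` and `θ`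
  have hY : faceY (thetaV s) ((fishJ ε hε hε2).depth x.1) = faceY (thetaV s') ((fishJ ε hε hε2).depth x'.1) :=
    eq_of_circleExp_eq h2 (by
      obtain ⟨a1, a2⟩ := abs_le.1 hy; obtain ⟨b1, b2⟩ := abs_le.1 hy'
      rw [abs_lt]; constructor <;> linarith [Real.pi_gt_three])
  obtain ⟨hee, hcos, hsin⟩ := face_inj (by linarith) (by linarith) hT hY
  have hθ : thetaV s = thetaV s' := by
    refine eq_of_circleExp_eq (Subtype.ext ?_) ?_
    · rw [Circle.coe_exp, Circle.coe_exp, Complex.exp_mul_I, Complex.exp_mul_I, ← Complex.ofReal_cos, ← Complex.ofReal_sin,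
        ← Complex.ofReal_cos, ← Complex.ofReal_sin, hcos, hsin]
    · rw [thetaV, thetaV, abs_lt]; constructor <;> nlinarith [hs.1, hs.2, hs'.1, hs'.2]
  have hss : s = s' := by rw [thetaV, thetaV] at hθ; nlinarith
  have hz1 : x.1 = x'.1 := z1_eq_of_depth_eq hε hε2 hx hx' hee
  -- the latitude gives `z₂`, the fibre gives `z₃`
  have hlat : (fishJ ε hε hε2).lat x.2.1 = (fishJ ε hε hε2).lat x'.2.1 := by
    have hexp : Circle.exp ((fishJ ε hε hε2).lat x.2.1) = Circle.exp ((fishJ ε hε hε2).lat x'.2.1) := by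
      have := congrArg (fun z : Circle ↦ z * (x.2.2 * (fishJ ε hε hε2).twistC ((fishJ ε hε hε2).lat x.2.1) s)) h1
      simp only [inv_mul_cancel_right] at this
      rw [this, h3, inv_mul_cancel_right]
    refine eq_of_circleExp_eq hexp ?_
    have hθ₀ : (fishJ ε hε hε2).θ₀ = 1 := rfl
    rw [IotaData.lat, IotaData.lat, hθ₀]
    have := Complex.arg_le_pi (x.2.1 : ℂ); have := Complex.neg_pi_lt_arg (x.2.1 : ℂ)
    have := Complex.arg_le_pi (x'.2.1 : ℂ); have := Complex.neg_pi_lt_arg (x'.2.1 : ℂ)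
    rw [abs_lt]; constructor <;> linarith
  have hz2 : x.2.1 = x'.2.1 := z2_eq_of_lat_eq hε hε2 hlat
  have hz3 : x.2.2 = x'.2.2 := by
    rw [hlat, hss] at h3; exact mul_right_cancel h3
  exact ⟨Prod.ext hz1 (Prod.ext hz2 hz3), hss⟩

include hε2 in
/-- **The corner is injective** in corner mode. [folklore] -/
theorem corner_inj {x x' : ThreeTorus} (hx : 0 < (x.1 : ℂ).im) (hx' : 0 < (x'.1 : ℂ).im) {s s' : ℝ}
    (hs : |s - 1| < 1 / 5) (hs' : |s' - 1| < 1 / 5)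
    (h1 : (fishJ ε hε hε2).rh ≤ ‖(fishJ ε hε hε2).holeP0 x s‖) (h2 : ‖(fishJ ε hε hε2).holeP0 x s‖ < (fishJ ε hε hε2).rc)
    (h1' : (fishJ ε hε hε2).rh ≤ ‖(fishJ ε hε hε2).holeP0 x' s'‖) (h2' : ‖(fishJ ε hε hε2).holeP0 x' s'‖ < (fishJ ε hε hε2).rc)
    (h : (fishJ ε hε hε2).cornerP x s = (fishJ ε hε hε2).cornerP x' s') : x = x' ∧ s = s' := by
  have hπ := Real.pi_pos
  obtain ⟨hrh0, -, -, -, -, hrc1, -, -, -, -, hp10⟩ := radii hε hε2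
  have hc := cL_pos ε hε hε2
  rw [cornerP_eq, cornerP_eq] at h
  obtain ⟨hfar, hS1, hS2, hWi, hWr⟩ := far_corner hε hε2 hx h1 h2
  obtain ⟨hfar', hS1', hS2', hWi', hWr'⟩ := far_corner hε hε2 hx' h1' h2'
  obtain ⟨hW0, -, -, -, -⟩ := corner_mem hε hε2 hx h1 h2
  obtain ⟨hW0', -, -, -, -⟩ := corner_mem hε hε2 hx' h1' h2'
  have hm := hfar.eq_of_toSurg_eq hε hε2 h
  obtain ⟨hX, hT⟩ := mtPt_inj_Ico ⟨by linarith, hS2⟩ ⟨by linarith, hS2'⟩ hm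
  obtain ⟨e1, e23⟩ := Prod.ext_iff.1 hX
  obtain ⟨e2, e3⟩ := Prod.ext_iff.1 e23
  simp only at e1 e2 e3
  have hE : cE hε hε2 x s = cE hε hε2 x' s' := by rw [bxH] at hT; linarith
  have hre : cW hε hε2 x s * (cU hε hε2 x s).re = cW hε hε2 x' s' * (cU hε hε2 x' s').re := by
    have hexp : Circle.exp (nj ε + cW hε hε2 x s * (cU hε hε2 x s).re) = Circle.exp (nj ε + cW hε hε2 x' s' * (cU hε hε2 x' s').re) := by
      have := congrArg (fun z : Circle ↦ z * cF hε hε2 x s) e1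
      simp only [inv_mul_cancel_right] at this
      rw [this, e3, inv_mul_cancel_right]
    have := eq_of_circleExp_eq hexp (by
      obtain ⟨a1, a2⟩ := abs_le.1 hWr; obtain ⟨b1, b2⟩ := abs_le.1 hWr'
      rw [abs_lt]; constructor <;> linarith [Real.pi_gt_three])
    linarith
  have him : cW hε hε2 x s * (cU hε hε2 x s).im = cW hε hε2 x' s' * (cU hε hε2 x' s').im := by
    have := eq_of_circleExp_eq e2 (by
      obtain ⟨a1, a2⟩ := abs_le.1 hWi; obtain ⟨b1, b2⟩ := abs_le.1 hWi'
      rw [abs_lt]; constructor <;> linarith [Real.pi_gt_three])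
    linarith
  -- `W u = W' u'` as complex numbers
  have hp0 : (fishJ ε hε hε2).holeP0 x s ≠ 0 := by rw [← norm_pos_iff]; linarith
  have hp0' : (fishJ ε hε hε2).holeP0 x' s' ≠ 0 := by rw [← norm_pos_iff]; linarith
  have hu1 : ‖cU hε hε2 x s‖ = 1 := by rw [cU, Circle.norm_coe]
  have hu1' : ‖cU hε hε2 x' s'‖ = 1 := by rw [cU, Circle.norm_coe]
  have hWu : (cW hε hε2 x s : ℂ) * cU hε hε2 x s = (cW hε hε2 x' s' : ℂ) * cU hε hε2 x' s' :=
    Complex.ext (by simp [hre]) (by simp [him])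
  have hWW : cW hε hε2 x s = cW hε hε2 x' s' := by
    have := congrArg (fun z : ℂ ↦ ‖z‖) hWu
    simp only [norm_mul, Complex.norm_real, Real.norm_eq_abs, hu1, hu1', mul_one, abs_of_pos hW0, abs_of_pos hW0'] at this
    exact this
  have huu : cU hε hε2 x s = cU hε hε2 x' s' := by
    rw [hWW] at hWu
    exact mul_left_cancel₀ (by exact_mod_cast hW0'.ne') hWu
  -- Gompf's bend is invertible: `(ϱ, e)` agree
  have hbend : (fishJ ε hε hε2).bendWE x s = (fishJ ε hε hε2).bendWE x' s' := Prod.ext hWW hE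
  have hinv := congrArg (fishBendInv (cL ε hε hε2) (p1 ε hε hε2) (rhoB ε hε hε2)) hbend
  rw [IotaData.bendWE, IotaData.bendWE] at hinv
  change fishBendInv _ _ _ (fishBend (cL ε hε hε2) (p1 ε hε hε2) (rhoB ε hε hε2) _) =
    fishBendInv _ _ _ (fishBend (cL ε hε hε2) (p1 ε hε hε2) (rhoB ε hε hε2) _) at hinv
  rw [fishBendInv_fishBend hc.ne', fishBendInv_fishBend hc.ne'] at hinv
  obtain ⟨hϱ, hee⟩ := Prod.ext_iff.1 hinv
  simp only at hϱ hee
  -- hence `p₀ = ϱ u` agrees, and everything follows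
  have hpp : (fishJ ε hε hε2).holeP0 x s = (fishJ ε hε hε2).holeP0 x' s' := by
    have e := norm_mul_exp_arg_mul_I ((fishJ ε hε hε2).holeP0 x s)
    have e' := norm_mul_exp_arg_mul_I ((fishJ ε hε hε2).holeP0 x' s')
    have hu : exp (arg ((fishJ ε hε hε2).holeP0 x s) * I) = exp (arg ((fishJ ε hε hε2).holeP0 x' s') * I) := by
      have := congrArg (fun z : Circle ↦ (z : ℂ)) (show unitC ((fishJ ε hε hε2).holeP0 x s) = unitC ((fishJ ε hε hε2).holeP0 x' s') from
        Subtype.ext huu)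
      simpa [unitC, Circle.coe_exp] using this
    rw [← e, ← e', hϱ, hu]
  obtain ⟨hz2, hss⟩ := decode_p0 hε hε2 hx' hs hs' hee hpp
  have hz1 : x.1 = x'.1 := z1_eq_of_depth_eq hε hε2 hx hx' hee
  have hz3 : x.2.2 = x'.2.2 := by
    have := e3
    rw [cF, cF, hpp, mul_assoc, mul_assoc] at this
    exact mul_right_cancel this
  exact ⟨Prod.ext hz1 (Prod.ext hz2 hz3), hss⟩

include hε2 in
/-- **The hole piece is injective** in hole mode. [folklore] -/
theorem hole_inj {x x' : ThreeTorus} (hx : 0 < (x.1 : ℂ).im) (hx' : 0 < (x'.1 : ℂ).im) {s s' : ℝ}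
    (hs : |s - 1| < 1 / 5) (hs' : |s' - 1| < 1 / 5)
    (h1 : ‖(fishJ ε hε hε2).holeP0 x s‖ < (fishJ ε hε hε2).rh) (h1' : ‖(fishJ ε hε hε2).holeP0 x' s'‖ < (fishJ ε hε hε2).rh)
    (h : (fishJ ε hε hε2).holeP x s = (fishJ ε hε hε2).holeP x' s') : x = x' ∧ s = s' := by
  have hc := cL_pos ε hε hε2
  obtain ⟨ht, hζ, hw, hW⟩ := hole_tube hε hε2 hx h1
  obtain ⟨ht', hζ', hw', hW'⟩ := hole_tube hε hε2 hx' h1'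
  have hLc : cL ε hε hε2 * rhJ ε hε hε2 < Lc ε + 3 / 100 := by rw [cL_mul_rhJ hε hε2]; linarith [E1_pos]
  rw [ht, ht'] at h
  have key := injOn_tubeD hε hε2 ⟨by linarith, hw⟩ ⟨by linarith, hw'⟩ h
  obtain ⟨hζζ, hww⟩ := Prod.ext_iff.1 key
  simp only at hζζ hww
  have hw_eq : (fishJ ε hε hε2).holeW x s = (fishJ ε hε hε2).holeW x' s' :=
    Complex.ext (Prod.ext_iff.1 hww).1 (Prod.ext_iff.1 hww).2
  -- the depth from `|w|`
  have hee : (fishJ ε hε hε2).depth x.1 = (fishJ ε hε hε2).depth x'.1 := by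
    have := congrArg (fun z : ℂ ↦ ‖z‖) hw_eq
    simp only [hW, hW'] at this
    field_simp at this; linarith
  -- `ζ w = c W p₀`
  have hprod : ∀ (y : ThreeTorus) (σ : ℝ), (fishJ ε hε hε2).holeZeta y σ * (fishJ ε hε hε2).holeW y σ =
      (cL ε hε hε2 : ℂ) * (((fishJ ε hε hε2).bendWE y σ).1 : ℂ) * (fishJ ε hε hε2).holeP0 y σ := by
    intro y σ
    rw [IotaData.holeZeta, IotaData.holeW]
    have hcc : (((fishJ ε hε hε2).cL : ℝ) : ℂ) = (cL ε hε hε2 : ℂ) := rfl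
    have h1 : ((Circle.exp (-(fishJ ε hε hε2).liftS ((fishJ ε hε hε2).holeP0 y σ)) : Circle) : ℂ) *
        ((Circle.exp ((fishJ ε hε hε2).liftS ((fishJ ε hε hε2).holeP0 y σ)) : Circle) : ℂ) = 1 := by
      rw [← Circle.coe_mul, ← Circle.exp_add, neg_add_cancel, Circle.exp_zero, Circle.coe_one]
    have h2 : ((y.2.2 : Circle) : ℂ) * (((y.2.2⁻¹ : Circle)) : ℂ) = 1 := by
      rw [← Circle.coe_mul, mul_inv_cancel, Circle.coe_one]
    rw [hcc]
    calc (cL ε hε hε2 : ℂ) * (fishJ ε hε hε2).holeP0 y σ * ((Circle.exp (-(fishJ ε hε hε2).liftS ((fishJ ε hε hε2).holeP0 y σ)) : Circle) : ℂ) *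
          ((y.2.2 : Circle) : ℂ) * ((((fishJ ε hε hε2).bendWE y σ).1 : ℂ) * ((Circle.exp ((fishJ ε hε hε2).liftS ((fishJ ε hε hε2).holeP0 y σ)) : Circle) : ℂ) *
          (((y.2.2⁻¹ : Circle)) : ℂ))
        = (cL ε hε hε2 : ℂ) * (((fishJ ε hε hε2).bendWE y σ).1 : ℂ) * (fishJ ε hε hε2).holeP0 y σ *
          (((Circle.exp (-(fishJ ε hε hε2).liftS ((fishJ ε hε hε2).holeP0 y σ)) : Circle) : ℂ) *
            ((Circle.exp ((fishJ ε hε hε2).liftS ((fishJ ε hε hε2).holeP0 y σ)) : Circle) : ℂ)) *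
          (((y.2.2 : Circle) : ℂ) * (((y.2.2⁻¹ : Circle)) : ℂ)) := by ring
      _ = (cL ε hε hε2 : ℂ) * (((fishJ ε hε hε2).bendWE y σ).1 : ℂ) * (fishJ ε hε hε2).holeP0 y σ := by rw [h1, h2]; ring
  have hWval : ((fishJ ε hε hε2).bendWE x s).1 = rhoB ε hε hε2 - (fishJ ε hε hε2).depth x.1 / cL ε hε hε2 := by
    rw [bendWE_of_hole hε hε2 hx h1]
  have hWval' : ((fishJ ε hε hε2).bendWE x' s').1 = rhoB ε hε hε2 - (fishJ ε hε hε2).depth x'.1 / cL ε hε hε2 := by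
    rw [bendWE_of_hole hε hε2 hx' h1']
  have hWpos : 0 < rhoB ε hε hε2 - (fishJ ε hε hε2).depth x.1 / cL ε hε hε2 := by rw [← hW]; exact norm_pos_iff.2 (by
    intro h0; rw [h0, norm_zero] at hW
    obtain ⟨he0, he1⟩ := depth_mem' hε hε2 hx
    have hec : (fishJ ε hε hε2).depth x.1 / cL ε hε hε2 < E1 / cL ε hε hε2 := div_lt_div_of_pos_right he1 hc
    linarith [E1_div_cL_le (hε := hε) (hε2 := hε2), rhoB_pos hε hε2])
  have hpp : (fishJ ε hε hε2).holeP0 x s = (fishJ ε hε hε2).holeP0 x' s' := by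
    have e := hprod x s; have e' := hprod x' s'
    rw [hζζ, hw_eq, e', hWval, hWval', ← hee] at e
    have hne : (cL ε hε hε2 : ℂ) * ((rhoB ε hε hε2 - (fishJ ε hε hε2).depth x.1 / cL ε hε hε2 : ℝ) : ℂ) ≠ 0 :=
      mul_ne_zero (by exact_mod_cast hc.ne') (by exact_mod_cast hWpos.ne')
    exact (mul_left_cancel₀ hne e).symm
  obtain ⟨hz2, hss⟩ := decode_p0 hε hε2 hx' hs hs' hee hpp
  have hz1 : x.1 = x'.1 := z1_eq_of_depth_eq hε hε2 hx hx' hee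
  have hz3 : x.2.2 = x'.2.2 := by
    have e := hw_eq
    rw [IotaData.holeW, IotaData.holeW, hpp, hWval, hWval', hee] at e
    have hne : ((rhoB ε hε hε2 - (fishJ ε hε hε2).depth x'.1 / cL ε hε hε2 : ℝ) : ℂ) *
        ((Circle.exp ((fishJ ε hε hε2).liftS ((fishJ ε hε hε2).holeP0 x' s')) : Circle) : ℂ) ≠ 0 :=
      mul_ne_zero (by rw [← hee]; exact_mod_cast hWpos.ne') (Circle.coe_ne_zero _)
    have := mul_left_cancel₀ hne e
    have := Subtype.ext this
    exact inv_injective this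
  exact ⟨Prod.ext hz1 (Prod.ext hz2 hz3), hss⟩

end PieceInj

/-! ### The pieces are disjoint -/

section Cross

/-- `cos (2π/5) < 1/√10` (so the face band `|s - 1| < 1/5` contains the flat top sector `|φ| ≤ arctan 3`). [folklore] -/
theorem cos_two_pi_div_five_lt : Real.cos (2 * π / 5) < 1 / Real.sqrt 10 := by
  have h5 : Real.cos (2 * π / 5) = (Real.sqrt 5 - 1) / 4 := by
    rw [show 2 * π / 5 = 2 * (π / 5) by ring, Real.cos_two_mul, Real.cos_pi_div_five]
    have : Real.sqrt 5 ^ 2 = 5 := Real.sq_sqrt (by norm_num)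
    nlinarith
  rw [h5, lt_div_iff₀ (Real.sqrt_pos.2 (by norm_num))]
  have hs5 : Real.sqrt 5 < 9 / 4 := by
    rw [Real.sqrt_lt' (by norm_num)]; norm_num
  have hs10 : Real.sqrt 10 < 16 / 5 := by
    rw [Real.sqrt_lt' (by norm_num)]; norm_num
  have hs50 : 1 < Real.sqrt 5 := by rw [Real.lt_sqrt (by norm_num)]; norm_num
  nlinarith [Real.sqrt_nonneg 10]

/-- `cos φ₁ = 1/√10`, `cos φ₂ = 1/√37`. [folklore] -/
theorem cos_bxPhi : Real.cos bxPhi1 = 1 / Real.sqrt 10 ∧ Real.cos bxPhi2 = 1 / Real.sqrt 37 := by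
  rw [bxPhi1, bxPhi2, Real.cos_arctan, Real.cos_arctan]; norm_num

/-- In the bend sector the radius profile is at least `h`. [folklore] -/
theorem bxH_le_bxR {θ : ℝ} (h0 : 0 < Real.sin θ) : bxH ≤ bxR θ := by
  have hb := topBump_mem bxPhi1 bxPhi2 θ
  have hH : (0:ℝ) < bxH := bxH_pos
  have hs1 : Real.sin θ ≤ 1 := Real.sin_le_one θ
  have hq : bxH ≤ bxH / Real.sin θ := by rw [le_div_iff₀ h0]; nlinarith
  rw [bxR, boxR]
  nlinarith [hb.1, hb.2]

include hε2 in
/-- **The hole piece misses the box shell.** [folklore] -/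
theorem hole_ne_box {x x' : ThreeTorus} (hx : 0 < (x.1 : ℂ).im) (hx' : 0 < (x'.1 : ℂ).im) {s : ℝ}
    (h1 : ‖(fishJ ε hε hε2).holeP0 x s‖ < (fishJ ε hε hε2).rh) (s' : ℝ) :
    (fishJ ε hε hε2).holeP x s ≠ (fishJ ε hε hε2).boxP x' s' := by
  intro h
  obtain ⟨ht, hζ, hw, -⟩ := hole_tube hε hε2 hx h1
  obtain ⟨ht1', ht2', hy'⟩ := box_mem hε hε2 hx' s'
  obtain ⟨he0', -⟩ := depth_mem' hε hε2 hx'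
  have htb : 1 < faceT (thetaV s') ((fishJ ε hε hε2).depth x'.1) := by rw [bxH] at ht1'; nlinarith
  have hfar := far_box hε hε2 hx' s'
  have hcY : cY = π - 1 / 4 := rfl
  rw [ht, boxP_eq] at h
  rcases hole_taxonomy hε hε2 (q := ((fishJ ε hε hε2).holeZeta x s, ((fishJ ε hε hε2).holeW x s).re, ((fishJ ε hε hε2).holeW x s).im)) hw hζ with
    ⟨b, hb⟩ | ⟨m, y, hm, hyC, hy⟩ | ⟨X, t, y, hm, ht0, ht1, -, -, -⟩ | ⟨X, t, hm, ht0, ht1⟩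
  · rw [hb] at h; exact hfar.toSurg_ne_inr hε hε2 b h.symm
  · rw [hm] at h
    have hmm := hfar.eq_of_toSurg_eq hε hε2 h.symm
    rw [← hmm, yC_mtPt _ (by linarith) (by linarith)] at hyC
    have := eq_of_circleExp_eq hyC (by
      obtain ⟨a1, a2⟩ := abs_le.1 hy'; obtain ⟨b1, b2⟩ := abs_le.1 hy
      rw [abs_lt]; constructor <;> linarith [Real.pi_gt_three, Real.pi_lt_d2])
    obtain ⟨a1, a2⟩ := abs_le.1 hy'; obtain ⟨b1, b2⟩ := abs_le.1 hy
    linarith [Real.pi_gt_three]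
  · rw [hm] at h
    have hmm := hfar.eq_of_toSurg_eq hε hε2 h.symm
    obtain ⟨-, hT⟩ := mtPt_inj_Ico ⟨htb.le.trans' (by norm_num), by linarith⟩ ⟨ht0.le, by linarith⟩ hmm
    linarith
  · rw [hm] at h
    have hmm := hfar.eq_of_toSurg_eq hε hε2 h.symm
    obtain ⟨-, hT⟩ := mtPt_inj_Ico ⟨htb.le.trans' (by norm_num), by linarith⟩ ⟨ht0.le, by rw [tH_eq] at ht1; linarith⟩ hmm
    rw [tH_eq] at ht1; linarith

/-- **In handle mode the bend is `(ρ_b - e/c, c(ϱ - ρ_b) + 2e)`.** [folklore] -/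
theorem bendWE_of_handle {x : ThreeTorus} {s : ℝ}
    (h : ‖(fishJ ε hε hε2).holeP0 x s‖ - rhoB ε hε hε2 + (fishJ ε hε hε2).depth x.1 / cL ε hε hε2 ≤ -p1 ε hε hε2) :
    (fishJ ε hε hε2).bendWE x s = (rhoB ε hε hε2 - (fishJ ε hε hε2).depth x.1 / cL ε hε hε2,
      cL ε hε hε2 * (‖(fishJ ε hε hε2).holeP0 x s‖ - rhoB ε hε hε2) + 2 * (fishJ ε hε hε2).depth x.1) := by
  obtain ⟨-, -, -, -, -, -, -, -, -, -, hp0⟩ := radii hε hε2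
  rw [IotaData.bendWE]
  exact fishBend_of_le (cL_pos ε hε hε2).ne' hp0 (by exact h)

include hε2 in
/-- **The corner in handle mode is a tube point** beyond the hole radius. [folklore] -/
theorem corner_handle {x : ThreeTorus} (hx : 0 < (x.1 : ℂ).im) {s : ℝ}
    (h1 : (fishJ ε hε hε2).rh ≤ ‖(fishJ ε hε hε2).holeP0 x s‖)
    (hh : ‖(fishJ ε hε hε2).holeP0 x s‖ - rhoB ε hε hε2 + (fishJ ε hε hε2).depth x.1 / cL ε hε hε2 ≤ -p1 ε hε hε2) :
    (fishJ ε hε hε2).cornerP x s = (fishT ε hε hε2).tubeD ((fishJ ε hε hε2).holeZeta x s, ((fishJ ε hε hε2).holeW x s).re, ((fishJ ε hε hε2).holeW x s).im) ∧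
      cL ε hε hε2 * rhJ ε hε hε2 ≤ ‖(fishJ ε hε hε2).holeZeta x s‖ ∧ ‖(fishJ ε hε hε2).holeZeta x s‖ < Lc ε ∧
      (((fishJ ε hε hε2).holeW x s).re, ((fishJ ε hε hε2).holeW x s).im) ∈ AdmP ε hε hε2 := by
  have H := locHyp hε hε2
  obtain ⟨hrh0, hrhJ, -, -, -, -, hδ0, -, -, -, hp0⟩ := radii hε hε2
  obtain ⟨he0, he1⟩ := depth_mem' hε hε2 hx
  have hc := cL_pos ε hε hε2
  have hp : (fishJ ε hε hε2).holeP0 x s ≠ 0 := by rw [← norm_pos_iff]; linarith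
  have hζn : ‖(fishJ ε hε hε2).holeZeta x s‖ = cL ε hε hε2 * ‖(fishJ ε hε hε2).holeP0 x s‖ := (fishJ ε hε hε2).norm_holeZeta hc x s
  have hge : (fishJ ε hε hε2).cL * ((fishJ ε hε hε2).rh - delC ε hε hε2) ≤ ‖(fishJ ε hε hε2).holeZeta x s‖ := by
    rw [hζn]; exact mul_le_mul_of_nonneg_left (by linarith) hc.le
  have heq := (fishJ ε hε hε2).holeP_eq_cornerP H.hc H.hp₁ hp (by exact hh)
    (fun a b ↦ (fishJ ε hε hε2).tubeD_of_le H (r := ((fishJ ε hε hε2).holeZeta x s, a, b)) hge) (H.hμ _ hge)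
  have hWE := bendWE_of_handle hε hε2 hh
  have hec0 : 0 < (fishJ ε hε hε2).depth x.1 / cL ε hε hε2 := div_pos he0 hc
  have hec : (fishJ ε hε hε2).depth x.1 / cL ε hε hε2 < E1 / cL ε hε hε2 := div_lt_div_of_pos_right he1 hc
  have hlo : 0 < rhoB ε hε hε2 - E1 / cL ε hε hε2 := by linarith [E1_div_cL_le (hε := hε) (hε2 := hε2), rhoB_pos hε hε2]
  have hnormW : ‖(fishJ ε hε hε2).holeW x s‖ = rhoB ε hε hε2 - (fishJ ε hε hε2).depth x.1 / cL ε hε hε2 := by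
    rw [IotaData.holeW, norm_mul, norm_mul, Circle.norm_coe, Circle.norm_coe, mul_one, mul_one, Complex.norm_real, Real.norm_eq_abs, hWE]
    exact abs_of_pos (by linarith)
  have hsq : ((fishJ ε hε hε2).holeW x s).re ^ 2 + ((fishJ ε hε hε2).holeW x s).im ^ 2 = ‖(fishJ ε hε hε2).holeW x s‖ ^ 2 := by
    rw [Complex.sq_norm, Complex.normSq_apply]; ring
  refine ⟨heq.symm, by rw [hζn, ← hrhJ]; exact mul_le_mul_of_nonneg_left h1 hc.le, ?_, ?_, ?_⟩
  · rw [hζn, ← cL_mul_rhoB' ε hε hε2]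
    exact mul_lt_mul_of_pos_left (by linarith) hc
  · show (rhoB ε hε hε2 - E1 / cL ε hε hε2) ^ 2 < ((fishJ ε hε hε2).holeW x s).re ^ 2 + ((fishJ ε hε hε2).holeW x s).im ^ 2
    rw [hsq, hnormW]; nlinarith
  · show ((fishJ ε hε hε2).holeW x s).re ^ 2 + ((fishJ ε hε hε2).holeW x s).im ^ 2 < rhoB ε hε hε2 ^ 2
    rw [hsq, hnormW]; nlinarith

include hε2 in
/-- **The hole piece misses the corner.** [folklore] -/
theorem hole_ne_corner {x x' : ThreeTorus} (hx : 0 < (x.1 : ℂ).im) (hx' : 0 < (x'.1 : ℂ).im) {s s' : ℝ}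
    (h1 : ‖(fishJ ε hε hε2).holeP0 x s‖ < (fishJ ε hε hε2).rh)
    (h1' : (fishJ ε hε hε2).rh ≤ ‖(fishJ ε hε hε2).holeP0 x' s'‖) (h2' : ‖(fishJ ε hε hε2).holeP0 x' s'‖ < (fishJ ε hε hε2).rc) :
    (fishJ ε hε hε2).holeP x s ≠ (fishJ ε hε hε2).cornerP x' s' := by
  intro h
  have hc := cL_pos ε hε hε2
  obtain ⟨ht, hζ, hw, -⟩ := hole_tube hε hε2 hx h1
  have hLc : cL ε hε hε2 * rhJ ε hε hε2 < Lc ε + 3 / 100 := by rw [cL_mul_rhJ hε hε2]; linarith [E1_pos]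
  by_cases hh : ‖(fishJ ε hε hε2).holeP0 x' s'‖ - rhoB ε hε hε2 + (fishJ ε hε hε2).depth x'.1 / cL ε hε hε2 ≤ -p1 ε hε hε2
  · -- handle mode: both are tube points, at different positions
    obtain ⟨ht', hlo', hhi', hw'⟩ := corner_handle hε hε2 hx' h1' hh
    rw [ht, ht'] at h
    have key := injOn_tubeD hε hε2 ⟨by linarith, hw⟩ ⟨by linarith, hw'⟩ h
    have := congrArg (fun q : ℂ × ℝ × ℝ ↦ ‖q.1‖) key
    simp only at this
    linarith
  · -- off the handle: the corner is far with `t > 249/250`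
    obtain ⟨-, -, -, -, hEp⟩ := corner_mem hε hε2 hx' h1' h2'
    have hE := hEp (not_le.1 hh)
    obtain ⟨hfar, hS1, hS2, hWi, -⟩ := far_corner hε hε2 hx' h1' h2'
    have hcY : cY = π - 1 / 4 := rfl
    rw [ht, cornerP_eq] at h
    rcases hole_taxonomy hε hε2 (q := ((fishJ ε hε hε2).holeZeta x s, ((fishJ ε hε hε2).holeW x s).re, ((fishJ ε hε hε2).holeW x s).im)) hw hζ with
      ⟨b, hb⟩ | ⟨m, y, hm, hyC, hy⟩ | ⟨X, t, y, hm, ht0, ht1, hXy, hy0, hy1⟩ | ⟨X, t, hm, ht0, ht1⟩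
    · rw [hb] at h; exact hfar.toSurg_ne_inr hε hε2 b h.symm
    · rw [hm] at h
      have hmm := hfar.eq_of_toSurg_eq hε hε2 h.symm
      rw [← hmm, yC_mtPt _ (by linarith) hS2] at hyC
      have := eq_of_circleExp_eq hyC (by
        obtain ⟨a1, a2⟩ := abs_le.1 hWi; obtain ⟨b1, b2⟩ := abs_le.1 hy
        rw [abs_lt]; constructor <;> linarith [Real.pi_gt_three, Real.pi_lt_d2])
      obtain ⟨a1, a2⟩ := abs_le.1 hWi; obtain ⟨b1, b2⟩ := abs_le.1 hy
      linarith [Real.pi_gt_three]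
    · rw [hm] at h
      have hmm := hfar.eq_of_toSurg_eq hε hε2 h.symm
      obtain ⟨hX, -⟩ := mtPt_inj_Ico ⟨by linarith, hS2⟩ ⟨ht0.le, by linarith⟩ hmm
      have h2c := congrArg (fun z : ThreeTorus ↦ z.2.1) hX
      simp only at h2c
      rw [hXy] at h2c
      have := eq_of_circleExp_eq h2c.symm (by
        obtain ⟨a1, a2⟩ := abs_le.1 hWi
        rw [abs_lt]; constructor <;> linarith [Real.pi_gt_three, Real.pi_lt_d2])
      obtain ⟨a1, a2⟩ := abs_le.1 hWi
      linarith [Real.pi_gt_three]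
    · rw [hm] at h
      have hmm := hfar.eq_of_toSurg_eq hε hε2 h.symm
      obtain ⟨-, hT⟩ := mtPt_inj_Ico ⟨by linarith, hS2⟩ ⟨ht0.le, by rw [tH_eq] at ht1; linarith⟩ hmm
      rw [tH_eq] at ht1; rw [bxH] at hT; linarith

/-- **Bottom sector of the box**: `t > 1 + E₁ h`. [folklore] -/
theorem faceT_bottom_gt {θ e : ℝ} (hθ : Real.sin θ ≤ Real.cos bxPhi2) (he0 : 0 < e) (he1 : e < E1) : 1 + E1 * bxH < faceT θ e := by
  obtain ⟨-, hc2⟩ := cos_bxPhi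
  have hE := E1_le
  have h37 : 0 < Real.sqrt 37 := Real.sqrt_pos.2 (by norm_num)
  have hs37 : 6 < Real.sqrt 37 := by rw [Real.lt_sqrt (by norm_num)]; norm_num
  have h6 : 1 / Real.sqrt 37 < 1 / 6 := by rw [div_lt_div_iff₀ h37 (by norm_num)]; linarith
  have hR : bxR θ = bxH := boxR_of_sin_le bxPhi1_nonneg bxPhi1_lt_bxPhi2 bxPhi2_le_pi hθ
  rw [faceT, hR, bxH]
  rw [hc2] at hθ
  rcases le_or_gt 0 (Real.sin θ) with hpos | hneg
  · have : (1 - e) * Real.sin θ ≤ 1 * (1 / Real.sqrt 37) := mul_le_mul (by linarith) hθ hpos (by norm_num)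
    nlinarith
  · nlinarith

/-- **Bend sector of the box**: `|y - c_Y| > 1/10`. [folklore] -/
theorem faceY_bend_far {θ e : ℝ} (h1 : Real.cos bxPhi2 < Real.sin θ) (h2 : Real.sin θ < Real.cos bxPhi1) (he0 : 0 < e) (he1 : e < E1) :
    1 / 10 < |faceY θ e - cY| := by
  obtain ⟨hc1, hc2⟩ := cos_bxPhi
  have hE := E1_le
  have h10 : 0 < Real.sqrt 10 := Real.sqrt_pos.2 (by norm_num)
  have hsinpos : 0 < Real.sin θ := lt_trans (by rw [hc2]; positivity) h1
  have hRge := bxH_le_bxR hsinpos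
  have hR0 := bxR_pos θ
  have hcos2 : 9 / 10 < Real.cos θ ^ 2 := by
    have hsq := Real.sin_sq_add_cos_sq θ
    have : Real.sin θ ^ 2 < (1 / Real.sqrt 10) ^ 2 := by rw [hc1] at h2; nlinarith
    rw [div_pow, one_pow, Real.sq_sqrt (by norm_num)] at this
    linarith
  have hlow : 99 / 500 ≤ (1 - e) * bxR θ := by rw [bxH] at hRge; nlinarith
  have habs : (1 / 10) ^ 2 < (faceY θ e - cY) ^ 2 := by
    rw [faceY, add_sub_cancel_left, mul_pow]
    nlinarith
  have : (1 / 10 : ℝ) ^ 2 < |faceY θ e - cY| ^ 2 := by rwa [sq_abs]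
  exact lt_of_pow_lt_pow_left₀ 2 (abs_nonneg _) this

/-- **Top sector of the box**: `cos φ₁ ≤ cos φ`, `|φ| ≤ π` give `|φ| ≤ φ₁ < 2π/5`. [folklore] -/
theorem abs_le_bxPhi1_of_cos_le {φ : ℝ} (h : Real.cos bxPhi1 ≤ Real.cos φ) (hφπ : |φ| ≤ π) : |φ| ≤ bxPhi1 ∧ |φ| < 2 * π / 5 := by
  obtain ⟨hc1, -⟩ := cos_bxPhi
  have hφabs : |φ| ≤ bxPhi1 := by
    by_contra hcon
    rw [not_le] at hcon
    have := Real.cos_lt_cos_of_nonneg_of_le_pi bxPhi1_nonneg hφπ hcon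
    rw [Real.cos_abs] at this
    linarith
  have hlt : bxPhi1 < 2 * π / 5 := by
    by_contra hcon; rw [not_lt] at hcon
    have := Real.cos_le_cos_of_nonneg_of_le_pi (by positivity) (bxPhi1_lt_bxPhi2.le.trans bxPhi2_le_pi) hcon
    rw [hc1] at this; linarith [cos_two_pi_div_five_lt]
  exact ⟨hφabs, lt_of_le_of_lt hφabs hlt⟩

include hε2 in
/-- **The corner misses the box shell** (box mode: `holeDist ≥ r_c`). [folklore] -/
theorem corner_ne_box {x x' : ThreeTorus} (hx : 0 < (x.1 : ℂ).im) (hx' : 0 < (x'.1 : ℂ).im) {s s' : ℝ}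
    (h1 : (fishJ ε hε hε2).rh ≤ ‖(fishJ ε hε hε2).holeP0 x s‖) (h2 : ‖(fishJ ε hε hε2).holeP0 x s‖ < (fishJ ε hε hε2).rc)
    (hs' : 1 / 2 ≤ s' ∧ s' < 3 / 2) (hbox : (fishJ ε hε hε2).rc ≤ (fishJ ε hε hε2).holeDist x' s') :
    (fishJ ε hε hε2).cornerP x s ≠ (fishJ ε hε hε2).boxP x' s' := by
  intro h
  have hπ := Real.pi_pos
  obtain ⟨hrh0, -, -, -, -, hrc1, -⟩ := radii hε hε2
  obtain ⟨hW0, hWrc, hE0, hE1, -⟩ := corner_mem hε hε2 hx h1 h2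
  obtain ⟨hfar, hS1, hS2, hWi, hWr⟩ := far_corner hε hε2 hx h1 h2
  obtain ⟨ht1', ht2', hy'⟩ := box_mem hε hε2 hx' s'
  obtain ⟨he0', he1'⟩ := depth_mem' hε hε2 hx'
  have hEE := E1_le
  set e' := (fishJ ε hε hε2).depth x'.1 with he'
  have hcY : cY = π - 1 / 4 := rfl
  rw [cornerP_eq, boxP_eq] at h
  have hmm := hfar.eq_of_toSurg_eq hε hε2 h
  obtain ⟨hX, hT⟩ := mtPt_inj_Ico ⟨by linarith, hS2⟩ ⟨by rw [bxH] at ht1'; nlinarith, by linarith⟩ hmm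
  obtain ⟨e1, e23⟩ := Prod.ext_iff.1 hX
  obtain ⟨e2, e3⟩ := Prod.ext_iff.1 e23
  simp only at e1 e2 e3
  -- the height: `faceY - cY = W im u`
  have hY : faceY (thetaV s') e' - cY = cW hε hε2 x s * (cU hε hε2 x s).im := by
    have := eq_of_circleExp_eq e2 (by
      obtain ⟨a1, a2⟩ := abs_le.1 hWi; obtain ⟨b1, b2⟩ := abs_le.1 hy'
      rw [abs_lt]; constructor <;> linarith [Real.pi_gt_three])
    linarith
  -- the latitude: `n_b - n_j = W re u`
  have hN : (fishJ ε hε hε2).lat x'.2.1 - nj ε = cW hε hε2 x s * (cU hε hε2 x s).re := by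
    have hexp : Circle.exp (nj ε + cW hε hε2 x s * (cU hε hε2 x s).re) = Circle.exp ((fishJ ε hε hε2).lat x'.2.1) := by
      have := congrArg (fun z : Circle ↦ z * cF hε hε2 x s) e1
      simp only [inv_mul_cancel_right] at this
      rw [this, e3, inv_mul_cancel_right]
    have hl : (fishJ ε hε hε2).lat x'.2.1 = arg (x'.2.1 : ℂ) - 1 + nj ε := rfl
    have := eq_of_circleExp_eq hexp (by
      rw [hl]
      have := Complex.arg_le_pi (x'.2.1 : ℂ); have := Complex.neg_pi_lt_arg (x'.2.1 : ℂ)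
      obtain ⟨a1, a2⟩ := abs_le.1 hWr
      rw [abs_lt]; constructor <;> linarith [Real.pi_gt_three])
    linarith
  -- the three sectors of the box angle
  have hsin : Real.sin (thetaV s') = Real.cos (2 * π * (s' - 1)) := sin_thetaV s'
  by_cases htop : Real.cos bxPhi1 ≤ Real.sin (thetaV s')
  · -- top sector: the face is flat and `p₀' = W u`, so `|p₀'| = W < r_c ≤ holeDist`
    have hφπ : |2 * π * (s' - 1)| ≤ π := by
      rw [abs_mul, abs_of_pos (by positivity : (0:ℝ) < 2 * π)]
      have : |s' - 1| ≤ 1 / 2 := abs_le.2 ⟨by linarith [hs'.1], by linarith [hs'.2]⟩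
      nlinarith
    rw [hsin] at htop
    obtain ⟨hφabs, h25⟩ := abs_le_bxPhi1_of_cos_le htop hφπ
    have hθ : |thetaV s' - π / 2| ≤ bxPhi1 := by
      rw [abs_thetaV_sub, ← abs_of_pos (by positivity : (0:ℝ) < 2 * π), ← abs_mul]; exact hφabs
    have hflat := faceY_flat_thetaV hθ e'
    have hs1 : |s' - 1| < 1 / 5 := by
      have h2π : (0:ℝ) < 2 * π := by positivity
      rw [abs_mul, abs_of_pos h2π, show 2 * π / 5 = 2 * π * (1 / 5) by ring] at h25
      exact lt_of_mul_lt_mul_left h25 h2π.le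
    have hdist : (fishJ ε hε hε2).holeDist x' s' = ‖(fishJ ε hε hε2).holeP0 x' s'‖ := by rw [IotaData.holeDist, if_pos hs1]
    obtain ⟨hr', hi'⟩ := holeP0_re_im hε hε2 x' s'
    have hp0 : (fishJ ε hε hε2).holeP0 x' s' = (cW hε hε2 x s : ℂ) * cU hε hε2 x s := by
      refine Complex.ext ?_ ?_
      · rw [Complex.re_ofReal_mul, hr', hN]
      · rw [Complex.im_ofReal_mul, hi', ← hY, hflat]; ring
    have hnorm : ‖(fishJ ε hε hε2).holeP0 x' s'‖ = cW hε hε2 x s := by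
      rw [hp0, norm_mul, Complex.norm_real, Real.norm_eq_abs, abs_of_pos hW0, cU, Circle.norm_coe, mul_one]
    rw [hdist, hnorm] at hbox
    linarith
  rw [not_le] at htop
  by_cases hbot : Real.sin (thetaV s') ≤ Real.cos bxPhi2
  · -- bottom sector: `t > 1 + E₁ h > t_c`
    have := faceT_bottom_gt hbot he0' he1'
    rw [← hT, bxH] at this
    nlinarith
  · -- bend sector: `|y - c_Y| > 1/10 ≥ |W im u|`
    have := faceY_bend_far (not_le.1 hbot) htop he0' he1'
    rw [hY] at this
    linarith [(abs_le.1 hWi).2, le_abs_self (cW hε hε2 x s * (cU hε hε2 x s).im), neg_abs_le (cW hε hε2 x s * (cU hε hε2 x s).im),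
      (abs_le.1 hWi).1]

end Cross

/-! ### Injectivity of the end map -/

section Main

include hε2 in
/-- **The modes of the end map on the second cylinder**: hole (`|s - 1| < 1/5`, `|p₀| < r_h`), corner
(`|s - 1| < 1/5`, `r_h ≤ |p₀| < r_c`) or box (`holeDist ≥ r_c`). [folklore] -/
theorem iotaTwo_modes (x : ThreeTorus) (s : ℝ) :
    (|s - 1| < 1 / 5 ∧ ‖(fishJ ε hε hε2).holeP0 x s‖ < (fishJ ε hε hε2).rh ∧ (fishJ ε hε hε2).iotaTwo (x, s) = (fishJ ε hε hε2).holeP x s) ∨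
    (|s - 1| < 1 / 5 ∧ (fishJ ε hε hε2).rh ≤ ‖(fishJ ε hε hε2).holeP0 x s‖ ∧ ‖(fishJ ε hε hε2).holeP0 x s‖ < (fishJ ε hε hε2).rc ∧
      (fishJ ε hε hε2).iotaTwo (x, s) = (fishJ ε hε hε2).cornerP x s) ∨
    ((fishJ ε hε hε2).rc ≤ (fishJ ε hε hε2).holeDist x s ∧ (fishJ ε hε hε2).iotaTwo (x, s) = (fishJ ε hε hε2).boxP x s) := by
  obtain ⟨hrh0, -, -, hrhρ, hρrc, hrc1, -⟩ := radii hε hε2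
  rw [IotaData.iotaTwo]
  by_cases hs : |s - 1| < 1 / 5
  · have hd : (fishJ ε hε hε2).holeDist x s = ‖(fishJ ε hε hε2).holeP0 x s‖ := by rw [IotaData.holeDist, if_pos hs]
    by_cases h1 : ‖(fishJ ε hε hε2).holeP0 x s‖ < (fishJ ε hε hε2).rh
    · left; refine ⟨hs, h1, ?_⟩
      rw [glueBy_of_lt (τ := fun p : ThreeTorus × ℝ ↦ (fishJ ε hε hε2).holeDist p.1 p.2) (by show (fishJ ε hε hε2).holeDist x s < _; rw [hd]; exact h1)]
    by_cases h2 : ‖(fishJ ε hε hε2).holeP0 x s‖ < (fishJ ε hε hε2).rc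
    · right; left; refine ⟨hs, not_lt.1 h1, h2, ?_⟩
      rw [glueBy_of_le (τ := fun p : ThreeTorus × ℝ ↦ (fishJ ε hε hε2).holeDist p.1 p.2) (by show _ ≤ (fishJ ε hε hε2).holeDist x s; rw [hd]; exact not_lt.1 h1),
        glueBy_of_lt (τ := fun p : ThreeTorus × ℝ ↦ (fishJ ε hε hε2).holeDist p.1 p.2) (by show (fishJ ε hε hε2).holeDist x s < _; rw [hd]; exact h2)]
    · right; right; refine ⟨by rw [hd]; exact not_lt.1 h2, ?_⟩
      rw [glueBy_of_le (τ := fun p : ThreeTorus × ℝ ↦ (fishJ ε hε hε2).holeDist p.1 p.2) (by show _ ≤ (fishJ ε hε hε2).holeDist x s; rw [hd]; linarith),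
        glueBy_of_le (τ := fun p : ThreeTorus × ℝ ↦ (fishJ ε hε hε2).holeDist p.1 p.2) (by show _ ≤ (fishJ ε hε hε2).holeDist x s; rw [hd]; exact not_lt.1 h2)]
  · have hd : (fishJ ε hε hε2).holeDist x s = 1 := by rw [IotaData.holeDist, if_neg hs]
    right; right; refine ⟨by rw [hd]; linarith, ?_⟩
    rw [glueBy_of_le (τ := fun p : ThreeTorus × ℝ ↦ (fishJ ε hε hε2).holeDist p.1 p.2) (by show _ ≤ (fishJ ε hε hε2).holeDist x s; rw [hd]; linarith),
      glueBy_of_le (τ := fun p : ThreeTorus × ℝ ↦ (fishJ ε hε hε2).holeDist p.1 p.2) (by show _ ≤ (fishJ ε hε hε2).holeDist x s; rw [hd]; linarith)]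

include hε2 in
/-- **The end map on the second cylinder is injective** on `s ∈ [1/2, 3/2)`, `im z₁ > 0`. [folklore] -/
theorem iotaTwo_injOn : InjOn (fishJ ε hε hε2).iotaTwo {p : ThreeTorus × ℝ | 1 / 2 ≤ p.2 ∧ p.2 < 3 / 2 ∧ 0 < (p.1.1 : ℂ).im} := by
  rintro ⟨x, s⟩ ⟨hs1, hs2, hx⟩ ⟨x', s'⟩ ⟨hs1', hs2', hx'⟩ heq
  simp only at hs1 hs2 hx hs1' hs2' hx' heq
  have key : x = x' ∧ s = s' := by
    rcases iotaTwo_modes hε hε2 x s with ⟨hs, hp, hv⟩ | ⟨hs, hp1, hp2, hv⟩ | ⟨hb, hv⟩ <;>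
      rcases iotaTwo_modes hε hε2 x' s' with ⟨hs', hp', hv'⟩ | ⟨hs', hp1', hp2', hv'⟩ | ⟨hb', hv'⟩ <;>
      rw [hv, hv'] at heq
    · exact hole_inj hε hε2 hx hx' hs hs' hp hp' heq
    · exact absurd heq (hole_ne_corner hε hε2 hx hx' hp hp1' hp2')
    · exact absurd heq (hole_ne_box hε hε2 hx hx' hp s')
    · exact absurd heq.symm (hole_ne_corner hε hε2 hx' hx hp' hp1 hp2)
    · exact corner_inj hε hε2 hx hx' hs hs' hp1 hp2 hp1' hp2' heq
    · exact absurd heq (corner_ne_box hε hε2 hx hx' hp1 hp2 ⟨hs1', hs2'⟩ hb')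
    · exact absurd heq.symm (hole_ne_box hε hε2 hx' hx hp' s)
    · exact absurd heq.symm (corner_ne_box hε hε2 hx' hx hp1' hp2' ⟨hs1, hs2⟩ hb)
    · exact box_inj hε hε2 hx hx' ⟨hs1, hs2⟩ ⟨hs1', hs2'⟩ heq
  rw [key.1, key.2]

/-- **Every point of the mapping torus is `[x, s]` with `s ∈ [1/2, 3/2)`.** [folklore] -/
theorem exists_mtPt_rep {ψ : ThreeTorus ≃ₘ⟮ModelWithCorners.prod (𝓡 1) (ModelWithCorners.prod (𝓡 1) (𝓡 1)),
    ModelWithCorners.prod (𝓡 1) (ModelWithCorners.prod (𝓡 1) (𝓡 1))⟯ ThreeTorus} (m : MTorus ψ) :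
    ∃ (x : ThreeTorus) (s : ℝ), 1 / 2 ≤ s ∧ s < 3 / 2 ∧ m = mtPt ψ x s := by
  rcases (mtGlueData ψ).exists_inl_or_inr m with ⟨⟨x, s⟩, rfl⟩ | ⟨⟨x, t⟩, rfl⟩
  · obtain ⟨hs0, hs1⟩ := coe_prop_pieceOne s
    by_cases h : (s : ℝ) < 1 / 2
    · refine ⟨ψ x, (s : ℝ) + 1, by linarith, by linarith, ?_⟩
      rw [mtPt_apply_add_one x ⟨hs0, h⟩, mtPt_of_mem_one x ⟨hs0, hs1⟩]
    · refine ⟨x, s, not_lt.1 h, by linarith, ?_⟩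
      rw [mtPt_of_mem_one x ⟨hs0, hs1⟩]
  · obtain ⟨ht0, ht1⟩ := coe_prop_pieceTwo t
    exact ⟨x, t, ht0.le, ht1, by rw [mtPt_of_mem_two x ⟨ht0, ht1⟩]⟩

/-- The depth circle of `[x, s]`. [folklore] -/
theorem z1Of_mtPt (H : (fishJ ε hε hε2).ModelHyp) (x : ThreeTorus) {s : ℝ} (hs0 : 0 < s) (hs1 : s < 3 / 2) :
    (fishJ ε hε hε2).z1Of H (mtPt ((fishJ ε hε hε2).Ψ H) x s) = x.1 := by
  by_cases h : 1 / 2 < s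
  · rw [mtPt_of_mem_two x ⟨h, hs1⟩]; rfl
  · rw [mtPt_of_mem_one x ⟨hs0, by linarith⟩]; rfl

/-- The end map at `[x, s]`, `s ∈ [1/2, 3/2)`. [folklore] -/
theorem iota_mtPt (H : (fishJ ε hε hε2).ModelHyp) (x : ThreeTorus) {s : ℝ} (hs0 : 1 / 2 ≤ s) (hs1 : s < 3 / 2) :
    (fishJ ε hε hε2).iota H (mtPt ((fishJ ε hε hε2).Ψ H) x s) = (fishJ ε hε hε2).iotaTwo (x, s) := by
  rcases hs0.lt_or_eq with hlt | heq
  · exact (fishJ ε hε hε2).iota_mtPt_two H x ⟨hlt, hs1⟩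
  · rw [← heq, mtPt_of_mem_one x (by norm_num), IotaData.iota_inl, IotaData.iotaOne]
    simp only
    rw [glueBy_of_le (τ := fun p : ThreeTorus × ℝ ↦ p.2) (by show (1:ℝ) / 2 ≤ 1 / 2; norm_num)]

include hε2 in
/-- **The restricted end map is injective.** [cite: GompfAGT2010, Lemma 2.2 (the fishtail neighbourhood embedded in X)] -/
theorem injective_iotaO (H : (fishJ ε hε hε2).ModelHyp) : Function.Injective ((fishJ ε hε hε2).iotaO H) := by
  rintro ⟨m, hm⟩ ⟨m', hm'⟩ h
  obtain ⟨x, s, hs0, hs1, rfl⟩ := exists_mtPt_rep m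
  obtain ⟨x', s', hs0', hs1', rfl⟩ := exists_mtPt_rep m'
  rw [IotaData.mem_endO, z1Of_mtPt hε hε2 H x (by linarith) hs1] at hm
  rw [IotaData.mem_endO, z1Of_mtPt hε hε2 H x' (by linarith) hs1'] at hm'
  change (fishJ ε hε hε2).iota H (mtPt _ x s) = (fishJ ε hε hε2).iota H (mtPt _ x' s') at h
  rw [iota_mtPt hε hε2 H x hs0 hs1, iota_mtPt hε hε2 H x' hs0' hs1'] at h
  have := iotaTwo_injOn hε hε2 ⟨hs0, hs1, hm⟩ ⟨hs0', hs1', hm'⟩ h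
  obtain ⟨hx, hs⟩ := Prod.ext_iff.1 this
  simp only at hx hs
  subst hx; subst hs
  rfl

end Main

end FP

end Literature.Topology.FourManifolds
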